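import Summits.QuantumFields.YangMills.Theorems.BalabanUVNodesN07JunctionBlockConstantDatum
import Summits.QuantumFields.YangMills.Theorems.BalabanUVNodesN07RecordCubeVfixTorusGauge
import Summits.QuantumFields.YangMills.Theorems.BalabanUVNodesN07Thm4RecordStructureSym152PhiEG
import Summits.QuantumFields.YangMills.Theorems.BalabanUVNodesN07NrmSymPhiOfCoverRow
import Summits.QuantumFields.YangMills.Theorems.BalabanUVNodesN07SymTauScheduleNumerics
import Summits.QuantumFields.YangMills.Theorems.BalabanUVNodesN07Thm4RecMemberOfCrown
import Literature.MathematicalPhysics.QuantumFieldTheory.Balaban1983to89.Node00.TorusCoverCubeRecordDentCells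
import Literature.MathematicalPhysics.QuantumFieldTheory.Balaban1983to89.Node00.LargeFieldReprOfRecord
import Literature.MathematicalPhysics.QuantumFieldTheory.Balaban1983to89.B8CrownU0PointwiseOscOfFacesRec
import Literature.MathematicalPhysics.QuantumFieldTheory.Balaban1983to89.B8CfgExpBondLetterRec
import HarnessLib

/-!
# N07 [B11] (= [15] = [Balaban1985Variational]) Sect. F — PRELIMINARIES OF THE JUNCTION's `hJ` (INTENT-35): the record does not dent inside `□̃` below level `j − 1`
# (the cell dictionary's no-dent rows from the collar), a spare direction, and ✓p760822's guard row from one number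

Cell `pub-ymgap`, width seat `pub-ymgap-dag-n07-w3` g14 (junction owner of the K0 road; INTENT-35a).  `--kind proof --supports stmt-QuantumFields-20541 --as helper` (K0⁷; count-neutral; 0 `def`).
[III] = [Balaban1988Convergent]; [15] = [Balaban1985Variational]; [I] = [Balaban1987RG1].
HONEST FRAMING: count-neutral bookkeeping; nothing of Bałaban asserted; `hJ` ∕ `hsup` ∕ HSEAM inhabited by nobody here; N05 ∕ N07 NOT discharged; K0⁷ ∕ K1⁹ NOT closed; counts unmoved;
R4 closes the conditional finite-𝕋⁴ rung `BalabanLadder.UV` only; the YM mass gap (Clay) is NOT proved by any of this; nothing continuum ∕ ℝ⁴ ∕ OS.  No `def`, no `instance`, no `notation`, no `sorry`.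
-/

set_option autoImplicit false

noncomputable section

open scoped BigOperators Matrix.Norms.L2Operator

namespace Summit.QuantumFields.YangMills.BalabanUVNodes.N07JunctionHJPrelims


open Literature.MathematicalPhysics.QuantumFieldTheory.Balaban1983to89
open Literature.MathematicalPhysics.QuantumFieldTheory.Balaban1983to89.Node00
open Literature.MathematicalPhysics.QuantumFieldTheory.Balaban1983to89.B12RegularSpaces111 (gaugeU expI grad)
open Literature.MathematicalPhysics.QuantumFieldTheory.Balaban1983to89.B15DeterminingSets (embIter)
open Literature.MathematicalPhysics.QuantumLattice (blockMap)
open B15Eq112TorusCover (cover cover_surjective)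
open B14DomainGeom (Pt Within)
open B8Eq131Cubes (box cube tcube tLo tHi ctr)
open B8Eq131CubesRec (tcubeZ cubeZ bLoZ bHiZ)
open B8Eq131CubesRecDictionary (mem_cubeZ_iff_add_ctrShift)
open B6SectAOperatorsV1 (RE dsE)
open B7Prop1Explicit (e gaugeAct U1)
open B7Prop1Local (AgreeOn InBox)
open B7Prop2Explicit (unitaryUnits unitaryUnits_le_U1 c2')
open B7Prop2Rec (C0Z)
open B7Prop2SpecialUnitary (specialUnitaryUnits specialUnitaryUnits_le_unitaryUnits)
open BlockAveragingZd (avgIterZ ctrShift)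
open B8Ineq132 (covDerivFwd InAk BondTouches)
open B8Eq140Level (SideTouches sideTouches_of_bondTouches)
open B8Eq138LandauZd (logCfg covLap)
open B8Eq138LandauZdRec (IsLandau138WZ)
open B8Eq119TwistedAxialRec (Restr129Z UnderZ underZ_iff_flmZ_eq)
open B7SectEFLinearisationRec (logCovIterZ)
open B8Eq184Proof (cfgExp)
open B8ScaledSupNorm (msup bondNorm)
open B8Eq146AExpansion (plaqCovDeriv iEta)
open B8Eq143PlaqExpansion (pdiv)
open B7AvgGaugeCovariance (uLev)
open B7SectCDGaugeAveragesRec (uavgZ)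
open B7SectEFLinearisationRec (uavgZG)
open B8Eq17ClassAkV1 (plaqsOf)
open MatrixLog (mlog)
open Literature.MathematicalPhysics.QuantumFieldTheory.BalabanImbrieJaffe1984to88.BIJ85AxialPropagator411 (BondSpace)
open T4Continuum (T4Family)
open ExpMeanLog (expMeanLogSU deltaSU)
open B12GaugeOrbits021 (IsResidual iter_gaugeAct_of_isResidual)
open B15Eq177GaugeInvariance (blockLift)
open T4AxialGaugeRooted (axialGaugeAt)
open B5Eq118OneStroke (iterBlockOf)
open Summit.QuantumFields.Balaban3D.Carriers (radialContourData)
open N07Thm4RecMemberOfCrown (sitesPerDir_anti)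
open N07Thm4RecordStructureSym152Phi (NrmSymPhiOfRecord)
open N07NormalisationSymOfRecord (symCd symTower_gaugeAct_blockLift)
open N07AxialTowerRepresentative (exists_residual_axialTower)
open N07RecordCubeVfixTorusGauge (exists_radialGauge_vfix_at_recordCube_residual)
open N07SymTauScheduleNumerics (schedule_of_fineLetter)
open N07JunctionBlockConstantDatum (exists_junction_blockConstant_datum)
open N07SymPhiTorusRowAtRecordCubeCell (torusRow_at_recordCube_cell)
open N07NrmSymPhiOfCoverRow (nrmSymPhiOfRecord_glued_of_coverRow towers_dichotomy_image_cube_zero cover_tower_mem_image_cube_of_mem_cubeDomains_Om)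
open N07RecordCubeTowerWindow (underZ_sub_anchor_of_blockMap_pow)
open N07DatumCrownSideConditions (lift_mem_unitaryUnits)
open B8CrownU0PointwiseOscOfFacesRec (pointwise_osc_of_faces_precomposed mem_sq_of_underZ_lamS)
open B8CfgExpBondLetterRec (norm_sub_one_le_of_logRow)
open B8BlockConstantLiftDentedRec (mem_sq_zero_of_underZ_lamS)

variable (F : T4Family) (N : ℕ) [NeZero N]

/-! ## §1  The record does not dent inside `□̃` below level `j − 1`: the cell dictionary's `hD` rows from the collar -/

omit [NeZero N] in
/-- ★ **THE NO-DENT ROW FROM THE COLLAR**: for a separated run `sq`, a datum `(K, j, idx)` with `1 ≤ n ≤ j − 1`, and the collar «`π(□̃) ⊆ Ω_{j−1}`»: every site of the cube family's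
`Ω_n^{(n)}(□) = π_n″□_n^{(n)}` lies in the record family's `Ω_n^{(n)}` (`domainsOfSeq sq.Ω j`): its fine block covers a site of `π″□₀ ⊆ π″□̃ ⊆ Ω_{j−1} ⊆ Ω_i` for every `1 ≤ i ≤ n`
([III] (2.1): the record's regions decrease). [cite: Balaban1985Variational, (144) p.300, (148)–(150) p.301; Balaban1988Convergent, (2.1)–(2.2) p.254; Balaban1987RG1, (0.1) p.251, (0.3) p.252] -/
theorem mem_domainsOfSeq_Om_of_collar {ν : Stage7Numerics} {M : ℕ} {g : ℕ → ℝ} {K k : ℕ} (sq : SeqOfRecord F ν M g K k)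
    {Mc ρ j : ℕ} (hk : j ≤ (F.P K).m + (F.P K).K) (hjk : j ≤ k) (hρ1 : 1 ≤ ρ) {idx : Pt (F.P K).d}
    (hcollar : cover (F.P K) '' tcube (F.P K).L (cornerP (F.P K) Mc ρ idx) (sideP (F.P K) Mc ρ) ρ j ⊆ sq.Ω (j - 1))
    {n : ℕ} (hn1 : 1 ≤ n) (hnj : n ≤ j - 1) {Y : Site (F.P K) n}
    (hY : Y ∈ (cubeDomains (F.P K) (cornerP (F.P K) Mc ρ idx) (sideP (F.P K) Mc ρ) ρ j hk).Om n) :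
    Y ∈ (domainsOfSeq sq.Ω j hk).Om n := by
  have hnj' : n ≤ j := hnj.trans (Nat.sub_le _ _)
  have hL2 : 2 ≤ (F.P K).L := by have := (F.P K).hL.2; omega
  rw [mem_domainsOfSeq_Om_iff sq.Ω hk hnj']
  intro xT hxT i hi1 hin
  -- `xT` covers a site of `π″□₀ ⊆ π″□̃`
  obtain ⟨xL, rfl⟩ := cover_surjective (P := F.P K) xT
  set w' : Pt (F.P K).d := blockMap ((F.P K).L ^ n) xL - fun _ => ((ctrShift (F.P K).L (j - n) : ℕ) : ℤ) with hw'
  have hbm : blockMap ((F.P K).L ^ n) xL = w' + fun _ => ((ctrShift (F.P K).L (j - n) : ℕ) : ℤ) := by rw [hw', sub_add_cancel]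
  have hyOm : coverAt (F.P K) n (w' + fun _ => ((ctrShift (F.P K).L (j - n) : ℕ) : ℤ)) ∈
      (cubeDomains (F.P K) (cornerP (F.P K) Mc ρ idx) (sideP (F.P K) Mc ρ) ρ j hk).Om n := by
    rw [← hbm, ← iterBlockOf_cover (hnj'.trans hk), hxT]; exact hY
  have hx : UnderZ (F.P K).L n w' (xL - fun _ => ((ctrShift (F.P K).L j : ℕ) : ℤ)) := underZ_sub_anchor_of_blockMap_pow (P := F.P K) hnj' hbm
  have hmem := cover_tower_mem_image_cube_of_mem_cubeDomains_Om hn1 hnj' hyOm hx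
  rw [sub_add_cancel] at hmem
  have htc : cover (F.P K) xL ∈ cover (F.P K) '' tcube (F.P K).L (cornerP (F.P K) Mc ρ idx) (sideP (F.P K) Mc ρ) ρ j :=
    Set.image_mono (B8Eq131Cubes.cube_subset_tcube hL2 hρ1 (Nat.zero_le j)) hmem
  exact sq.chain.Ω_antitone hi1 (hin.trans hnj) (by omega) (hcollar htc)

/-! ## §2  Two small bookkeeping lemmas -/

omit [NeZero N] in
/-- In dimension `≥ 2` every direction has a different one. [cite: Balaban1985RegularSpaces, p.77 (convention before (1.5); bookkeeping)] -/
theorem exists_ne_dir {d : ℕ} (hd : 2 ≤ d) (μ : Fin d) : ∃ κ : Fin d, κ ≠ μ := by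
  by_cases h : (μ : ℕ) = 0
  · exact ⟨⟨1, by omega⟩, fun hh => by have := congrArg Fin.val hh; simp at this; omega⟩
  · exact ⟨⟨0, by omega⟩, fun hh => by have := congrArg Fin.val hh; simp at this; omega⟩

omit [NeZero N] in
/-- `θ`-powers are at most one: the guard row of ✓p760822 from ONE number. [cite: Balaban1987RG1, (0.4) p.253 (bookkeeping)] -/
theorem guardN_of_one {ωτ ωu θ δ : ℝ} (hθ0 : 0 ≤ θ) (hθ1 : θ ≤ 1) (hωτ : 0 ≤ ωτ) (hωu : 0 ≤ ωu)
    (h : 4 * (ωτ + ωu) + 32768 * (ωτ + ωu) ^ 2 < δ) (j i : ℕ) :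
    4 * ωτ * θ ^ (j - (i + 1)) + 4 * ωu * θ ^ (j - (i + 1)) + 2 * (1024 * (4 * (ωτ + ωu) * θ ^ (j - i)) ^ 2) < δ := by
  have h1 : θ ^ (j - (i + 1)) ≤ 1 := pow_le_one₀ hθ0 hθ1
  have h2 : θ ^ (j - i) ≤ 1 := pow_le_one₀ hθ0 hθ1
  have h2' : 0 ≤ θ ^ (j - i) := pow_nonneg hθ0 _
  have h3 : (4 * (ωτ + ωu) * θ ^ (j - i)) ^ 2 ≤ (4 * (ωτ + ωu)) ^ 2 := by
    have h4 : 0 ≤ 4 * (ωτ + ωu) * θ ^ (j - i) := by positivity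
    have h5 : 4 * (ωτ + ωu) * θ ^ (j - i) ≤ 4 * (ωτ + ωu) := mul_le_of_le_one_right (by positivity) h2
    exact pow_le_pow_left₀ h4 h5 2
  nlinarith [mul_le_of_le_one_right hωτ h1, mul_le_of_le_one_right hωu h1]

end Summit.QuantumFields.YangMills.BalabanUVNodes.N07JunctionHJPrelims

end
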